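import Literature.AlgebraicGeometry.Resolution.IdealSheafFlatDescent
import Literature.AlgebraicGeometry.Resolution.KollarEtaleNeighbourhood
import Mathlib.AlgebraicGeometry.Noetherian
import HarnessLib

/-!
# [OURS · L1 W4.5b · T-DIRLIFT-UP route C, brick B6 of C1c] Spreading germs, memberships and stalk presentations of ideal sheaves to a
# basic open neighbourhood

Cell res-hironaka, LADDER-RESOLUTION rung L, slot W4.5(b), crux chain w45b (EL♮(3) = stmt-ResolutionOfSingularities-20148); object
T-DIRLIFT-UP (res-L1-w45b-plan-1 RULING 19:14:55Z, route C), brick C1c (`L/res-D-pv-051/TARGET-C1c.sig.lean` b928b225abc4a457), sub-brick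
B6 (generic ideal-sheaf statements on a scheme; B5 «direction coordinates on a chart» consumes them).
`--supports stmt-ResolutionOfSingularities-20148 --as helper`. THEOREMS ONLY; def-free; NOT a statement of any manuscript; AI-written,
AI review weaker than expert review.

WHAT. `X` a scheme, `U ∋ x` an affine open.
* `exists_basicOpen_sections_of_germs`: finitely many germs at `x` are germs of sections over ONE basic open `D(r) ∋ x` of `U`;
* `exists_basicOpen_res_mem_ideal`: a section whose germ lies in `J_x` lies in `J(D(r))` for some basic open `D(r) ∋ x`
  (tree `exists_basicOpen_forall_germ_mem_stalkIdeal` + `mem_ideal_iff_forall_germ_mem_stalkIdeal`);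
* `exists_basicOpen_ideal_eq_map` (`X` locally Noetherian): if an ideal `K ⊆ Γ(X, U)` presents the stalk, `J_x = K·𝒪_{X,x}`, then
  `J(D(r)) = K·Γ(X, D(r))` on some basic open `D(r) ∋ x` — the many-generators form of the tree's `exists_basicOpen_ideal_eq_span`
  (`IdealSheafLocalGenerator.lean`; Görtz–Wedhorn I Prop. 7.30): clear the finitely many denominators of generators of `J(U)` and of `K`.
-/

noncomputable section

open CategoryTheory AlgebraicGeometry Opposite TopologicalSpace
open Literature.AlgebraicGeometry.Resolution

set_option linter.dupNamespace false -- mandated namespace `Summit.<Summit>.<Problem>` of this single-conjunct summit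

namespace Summit.ResolutionOfSingularities.ResolutionOfSingularities.Cruxes.EquisingularLiftNat.Sections

universe u

variable {X : Scheme.{u}}

/-! ## 1. Germs are sections over a basic open -/

/-- `a ∣ b` gives `D(b) ≤ D(a)`. [folklore] -/
theorem basicOpen_le_of_dvd {U : X.Opens} {a b : Γ(X, U)} (h : a ∣ b) : X.basicOpen b ≤ X.basicOpen a := by
  obtain ⟨c, rfl⟩ := h
  rw [Scheme.basicOpen_mul]
  exact inf_le_left

/-- A germ at `x ∈ U` (`U` affine) is the germ of a section over a basic open `D(r) ∋ x` of `U`. [folklore] -/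
theorem exists_basicOpen_section_of_germ (U : X.affineOpens) {x : X} (hx : x ∈ (U : X.Opens)) (g : X.presheaf.stalk x) :
    ∃ (r : Γ(X, U)) (hxr : x ∈ X.basicOpen r) (s : Γ(X, X.affineBasicOpen r)),
      (X.presheaf.germ (X.affineBasicOpen r) x hxr).hom s = g := by
  obtain ⟨V, hxV, t, ht⟩ := TopCat.Presheaf.exists_germ_eq X.presheaf g
  obtain ⟨r, hrV, hxr⟩ := U.2.exists_basicOpen_le ⟨x, hxV⟩ hx
  refine ⟨r, hxr, X.presheaf.map (homOfLE hrV).op t, ?_⟩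
  rw [← ht]
  exact TopCat.Presheaf.germ_res_apply X.presheaf (homOfLE hrV) x hxr t

/-- **Finitely many germs are sections over one basic open.** [folklore] -/
theorem exists_basicOpen_sections_of_germs (U : X.affineOpens) {x : X} (hx : x ∈ (U : X.Opens)) {ι : Type*} [Fintype ι]
    (g : ι → X.presheaf.stalk x) :
    ∃ (r : Γ(X, U)) (hxr : x ∈ X.basicOpen r) (s : ι → Γ(X, X.affineBasicOpen r)),
      ∀ i, (X.presheaf.germ (X.affineBasicOpen r) x hxr).hom (s i) = g i := by
  classical
  choose r hxr s hs using fun i => exists_basicOpen_section_of_germ U hx (g i)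
  have hle : ∀ i, X.basicOpen (∏ j, r j) ≤ X.basicOpen (r i) := fun i =>
    basicOpen_le_of_dvd (Finset.dvd_prod_of_mem r (Finset.mem_univ i))
  have hxr' : x ∈ X.basicOpen (∏ j, r j) := by
    rw [X.mem_basicOpen _ x hx, map_prod]
    exact IsUnit.prod_univ_iff.mpr fun i => (X.mem_basicOpen (r i) x hx).mp (hxr i)
  refine ⟨∏ j, r j, hxr', fun i => X.presheaf.map (homOfLE (hle i)).op (s i), fun i => ?_⟩
  rw [← hs i]
  exact TopCat.Presheaf.germ_res_apply X.presheaf (homOfLE (hle i)) x hxr' (s i)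

/-! ## 2. A membership at a stalk holds on a basic open -/

/-- **Spreading a membership.** If the germ at `x` of `t ∈ Γ(X, U)` lies in `J_x`, then `t|_{D(r)} ∈ J(D(r))` for some basic open
`D(r) ∋ x` of `U`. [folklore] -/
theorem exists_basicOpen_res_mem_ideal (J : X.IdealSheafData) (U : X.affineOpens) {x : X} (hx : x ∈ (U : X.Opens)) (t : Γ(X, U))
    (ht : (X.presheaf.germ U x hx).hom t ∈ stalkIdeal J x) :
    ∃ (r : Γ(X, U)) (_ : x ∈ X.basicOpen r),
      X.presheaf.map (homOfLE (X.basicOpen_le r)).op t ∈ J.ideal (X.affineBasicOpen r) := by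
  obtain ⟨r, hxr, hr⟩ := exists_basicOpen_forall_germ_mem_stalkIdeal J U hx t ht
  refine ⟨r, hxr, (mem_ideal_iff_forall_germ_mem_stalkIdeal J (X.affineBasicOpen r) _).mpr fun y hy => ?_⟩
  change (X.presheaf.germ (X.basicOpen r) y hy).hom (X.presheaf.map (homOfLE (X.basicOpen_le r)).op t) ∈ stalkIdeal J y
  have e : (X.presheaf.germ (X.basicOpen r) y hy).hom (X.presheaf.map (homOfLE (X.basicOpen_le r)).op t) =
      (X.presheaf.germ U y (X.basicOpen_le r hy)).hom t :=
    TopCat.Presheaf.germ_res_apply X.presheaf (homOfLE (X.basicOpen_le r)) y hy t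
  rw [e]
  exact hr y hy

/-! ## 3. A presentation of the stalk holds on a basic open (locally Noetherian) -/

/-- **Spreading a presentation of the stalk.** On a locally Noetherian scheme, if an ideal `K ⊆ Γ(X, U)` (`U ∋ x` affine) presents the
stalk of the ideal sheaf `J` at `x`, `J_x = K · 𝒪_{X,x}`, then `J(D(r)) = K · Γ(X, D(r))` for some basic open `D(r) ∋ x` of `U`
(generators `g` of `J(U)` have `t_g g ∈ K`, generators `k` of `K` have `s_k k ∈ J(U)`, with `t_g, s_k ∉ 𝔭_x`; take `r = ∏ t_g ∏ s_k`).
[cite: GortzWedhorn2020, Prop. 7.30] -/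
theorem exists_basicOpen_ideal_eq_map [IsLocallyNoetherian X] (J : X.IdealSheafData) (U : X.affineOpens) {x : X}
    (hx : x ∈ (U : X.Opens)) (K : Ideal Γ(X, U)) (h : stalkIdeal J x = K.map (X.presheaf.germ U x hx).hom) :
    ∃ (r : Γ(X, U)) (_ : x ∈ X.basicOpen r),
      J.ideal (X.affineBasicOpen r) = K.map (X.presheaf.map (homOfLE (X.basicOpen_le r)).op).hom := by
  classical
  haveI : IsNoetherianRing Γ(X, U) := IsLocallyNoetherian.component_noetherian U
  letI alg : Algebra Γ(X, U) (X.presheaf.stalk x) := (X.presheaf.germ U x hx).hom.toAlgebra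
  set p : Ideal Γ(X, U) := (U.2.primeIdealOf ⟨x, hx⟩).asIdeal with hp
  haveI : IsLocalization.AtPrime (X.presheaf.stalk x) p := U.2.isLocalization_stalk ⟨x, hx⟩
  have hp' : p.IsPrime := inferInstance
  have hJU : (J.ideal U).map (algebraMap Γ(X, U) (X.presheaf.stalk x)) = K.map (algebraMap Γ(X, U) (X.presheaf.stalk x)) := by
    change (J.ideal U).map (X.presheaf.germ U x hx).hom = K.map (X.presheaf.germ U x hx).hom
    rw [← stalkIdeal_eq_map_germ J U hx, h]
  -- generators of `J(U)` and of `K` with their multipliers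
  obtain ⟨gens, hgens⟩ := (IsNoetherian.noetherian (J.ideal U) : (J.ideal U).FG)
  obtain ⟨kens, hkens⟩ := (IsNoetherian.noetherian K : K.FG)
  have h1 : ∀ g ∈ gens, ∃ t : Γ(X, U), t ∉ p ∧ t * g ∈ K := by
    intro g hg
    have hmem : algebraMap Γ(X, U) (X.presheaf.stalk x) g ∈ K.map (algebraMap Γ(X, U) (X.presheaf.stalk x)) := by
      rw [← hJU]
      exact Ideal.mem_map_of_mem _ (hgens ▸ Submodule.subset_span hg)
    rw [IsLocalization.algebraMap_mem_map_algebraMap_iff p.primeCompl] at hmem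
    obtain ⟨t, ht, htg⟩ := hmem
    exact ⟨t, ht, htg⟩
  choose! t ht using h1
  have h2 : ∀ k ∈ kens, ∃ s : Γ(X, U), s ∉ p ∧ s * k ∈ J.ideal U := by
    intro k hk
    have hmem : algebraMap Γ(X, U) (X.presheaf.stalk x) k ∈ (J.ideal U).map (algebraMap Γ(X, U) (X.presheaf.stalk x)) := by
      rw [hJU]
      exact Ideal.mem_map_of_mem _ (hkens ▸ Submodule.subset_span hk)
    rw [IsLocalization.algebraMap_mem_map_algebraMap_iff p.primeCompl] at hmem
    obtain ⟨s, hs, hsk⟩ := hmem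
    exact ⟨s, hs, hsk⟩
  choose! s hs using h2
  -- the basic open `D(r)`, `r = ∏ t_g · ∏ s_k ∉ 𝔭`
  have htp : (∏ g ∈ gens, t g) ∉ p := fun hmem => by
    obtain ⟨g, hg, htg⟩ := hp'.prod_mem_iff.mp hmem
    exact (ht g hg).1 htg
  have hsp : (∏ k ∈ kens, s k) ∉ p := fun hmem => by
    obtain ⟨k, hk, hsk⟩ := hp'.prod_mem_iff.mp hmem
    exact (hs k hk).1 hsk
  set r : Γ(X, U) := (∏ g ∈ gens, t g) * ∏ k ∈ kens, s k with hr
  have hrp : r ∉ p := fun hmem => (hp'.mem_or_mem hmem).elim htp hsp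
  refine ⟨r, ?_, ?_⟩
  · rw [X.mem_basicOpen r x hx]
    exact (IsLocalization.AtPrime.isUnit_to_map_iff (X.presheaf.stalk x) p r).mpr hrp
  · let res := (X.presheaf.map (homOfLE (X.basicOpen_le r)).op).hom
    letI algL : Algebra Γ(X, U) Γ(X, X.affineBasicOpen r) := res.toAlgebra
    haveI : IsLocalization.Away r Γ(X, X.affineBasicOpen r) := U.2.isLocalization_basicOpen r
    have hunit : ∀ a : Γ(X, U), a ∣ r → IsUnit (res a) := fun a ha =>
      isUnit_of_dvd_unit (map_dvd res ha) (IsLocalization.Away.algebraMap_isUnit (S := Γ(X, X.affineBasicOpen r)) r)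
    rw [← J.map_ideal_basicOpen U r]
    change (J.ideal U).map res = K.map res
    apply le_antisymm
    · rw [← hgens, Ideal.map_span, Ideal.span_le]
      rintro _ ⟨g, hg, rfl⟩
      have hg' : g ∈ gens := hg
      rw [SetLike.mem_coe]
      have hmem : res (t g * g) ∈ K.map res := Ideal.mem_map_of_mem res (ht g hg').2
      rw [map_mul] at hmem
      exact (Ideal.unit_mul_mem_iff_mem _ (hunit (t g) ⟨(∏ g' ∈ gens.erase g, t g') * ∏ k ∈ kens, s k, by
        rw [hr, ← Finset.mul_prod_erase _ _ hg']; ring⟩)).mp hmem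
    · rw [← hkens, Ideal.map_span, Ideal.span_le]
      rintro _ ⟨k, hk, rfl⟩
      have hk' : k ∈ kens := hk
      rw [SetLike.mem_coe]
      have hmem : res (s k * k) ∈ (J.ideal U).map res := Ideal.mem_map_of_mem res (hs k hk').2
      rw [map_mul] at hmem
      exact (Ideal.unit_mul_mem_iff_mem _ (hunit (s k) ⟨(∏ g ∈ gens, t g) * ∏ k' ∈ kens.erase k, s k', by
        rw [hr, ← Finset.mul_prod_erase _ _ hk']; ring⟩)).mp hmem

end Summit.ResolutionOfSingularities.ResolutionOfSingularities.Cruxes.EquisingularLiftNat.Sections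

end
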